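import Literature.MathematicalPhysics.QuantumFieldTheory.BalabanImbrieJaffe1984to88.BIJ88RestrictionsL1Decay308
import Literature.MathematicalPhysics.QuantumFieldTheory.BalabanImbrieJaffe1984to88.BIJ88GaussShellNoncentred309
import Literature.MathematicalPhysics.QuantumFieldTheory.BalabanImbrieJaffe1984to88.BIJ88EffectiveActionGauss308

/-!
# `BalabanImbrieJaffe1984to88.BIJ88EffectiveActionNoncentred308` — T. Bałaban, J. Imbrie, A. Jaffe, *Effective action and cluster properties of
the abelian Higgs model*, Commun. Math. Phys. **114** (1988) 257–315 [BalabanImbrieJaffe1988], Sect. 5.14 p. 308 [PDF 52]: *"Thus the restrictions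
and the interactions disappear at t = 0, at which point we have a purely Gaussian expectation. Thus we define perturbative terms for the action,
𝒫̃_{k+1}(Λ₁₂^{(k)}) = Σ_{α=1}^{n̄} −(1/α!)(dᵅ/dtᵅ) log z_t(Λ₁₂^{(k)})|_{t=0}, (5.14.1) and a remainder ℛ_k(Λ₁₂^{(k)}) = ∫₀¹ dt −((1−t)^{n̄}/(n̄+1)!)
⟨d/dt; …; d/dt⟩_t. (5.14.2)"*, with p. 304 *"The expectation ⟨ ⟩_1 is in the measure (1/N)∫dΦ … exp[½⟨Φ,ΔΦ⟩ + ⟨Φ,ℱ⟩]"* (sic: no minus sign in print — its Δ is the negative of the positive form `Δ` of `fieldLaw`, cf. (5.13.2)) and p. 305 *"Recall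
that we have a linear term in the measure, ⟨Φ,ℱ⟩"* — **(5.14.1)–(5.14.2) AT THE `t = 0` END FOR NON-CENTRED GAUSSIAN FIELDS**: the centring
hypothesis of this seat's gens 8–11 (`h0 : E Φ_b = 0`, in the §5.13 model `hcen : Φ_b(ext Δ_W⁻¹ℱ_W) = 0` of `BIJ88EffectiveActionGauss308`) is
REMOVED.  The §5.13 law `fieldLaw blk Δ ℱ W` has mean `Δ_W⁻¹ℱ_W ≠ 0` for the boundary source `ℱ` of p. 305, so this is the form the corner
assembly of (5.14.5) (row C2.Eq5.14.5, p25/r16) consumes.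

statement-level skeleton of published theorems with citation tags; proofs where landed; nothing here is a claim about the Yang–Mills mass gap

PDF held: `paper:balaban1988-cmp114-bij-abelian-higgs-effective-action` (journal page = PDF page + 256); pp. 304–305, 308–309 = PDF 48–49, 52–53.

WHAT IS REPRODUCED (unit `lit-balaban-p36`, generation 12 of the Phase-2 proof seat p36, file 3 of 3; SKELETON rows **C2.Eq5.14.1-5.14.2**
((5.14.1)–(5.14.2), member), **C2.Eq5.14.3-5.14.4** (member), **C2.Claim@310** (member) of `HOME/lit-balaban-r16/ROWS-C2-part2.md`, owner r16,
heads untouched; HOME `run/shared/lean/pub/lit-balaban/`).  Theorems only (0 definitions, 0 `Prop` facts):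
* §1 THE p. 308 FAMILY `z_t = ∫ Π_b χ(c_b p(te_k), Φ_b) e^{−tṼ} dP` ON A PROBABILITY SPACE (`BIJ88SlotMoments308.zt`): `contDiffOn_uIcc_log_zt_of_L1`;
  **`effectiveAction_eq_pertP_add_sum_slotTrunc_of_contDiffOn`** and **`effectiveAction_eq_pertP_add_remR_ursell_of_contDiffOn`** (gens 10–11's
  `t = 0` end with the two Gaussian inputs made explicit: `z_t > 0` on `(0,1]` and `log z ∈ C^{n̄+1}[0,1]`); **`…_of_L1`** (the p. 309 sentence
  as the L¹ hypothesis `hL1`); **`effectiveAction_eq_pertP_add_remR_ursell_of_hasGaussianLaw`** (Gaussian-law marginals with ANY means + `z_t > 0`);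
  **`effectiveAction_eq_pertP_add_remR_ursell_of_mean`** (jointly Gaussian fields with means in the small-field box `|EΦ_b| < (9/10)c₀`, `χ ≥ 0`:
  no standing hypothesis — gen 11's `BIJ88SlotCumulants308.effectiveAction_eq_pertP_add_remR_ursell` WITHOUT `h0`); `pertP_log_zt_eq_pertPart_cgf_of_L1`.
* §2 THE §5.13 GAUSSIAN MODEL (`fieldLaw blk Δ ℱ W`, LINEAR slot fields, ANY source `ℱ`): `slotFields_L1` (`hL1` holds), `contDiffOn_uIcc_log_zG`
  (`log z_t ∈ Cⁿ[0,1]`), **`effectiveAction_fieldLaw_eq_pertP_add_remR_ursell'`**, **`effectiveAction_fieldLaw_eq_pertP_add_remR_Tsum_of_ineq5144'`**,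
  **`abs_effectiveAction_sub_pertP_le_of_ineq5144'`** — the three MODEL theorems of gen 11's `BIJ88EffectiveActionGauss308` with `hcen` DELETED
  (positivity structural by `BIJ88SlotMomentsGauss308.zG_fD_empty_pos`, `hL1` by `BIJ88GaussShellNoncentred309`), and
  `pertP_log_zG_eq_pertPart_cgf` (print's `𝒫̃_{k+1}` in the model = the cumulant sum of `−Ṽ` under the non-centred law).
HONEST SCOPE: (a) slot fields LINEAR (print: components of `(I − Q_s*Q)A^{(k)}`, `φ^{(k)″}`); (b) (5.14.4) is the typed leaf
`BIJ88Sect5StatementsPart2.Ineq5144`, used only in the last two model theorems; (c) `(n̄+1)!` vs `n̄!` = located slip GAPS G-C2-p36-06 (both forms);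
(d) `Δ := −Δ_print` convention of p25's `BIJ88PolymerRep5134Gauss`.  0 `sorry`, 0 definitions, 0 new `Prop` facts (D-0026); imports this generation's
`BIJ88RestrictionsL1Decay308`, `BIJ88GaussShellNoncentred309` and gen 11's `BIJ88EffectiveActionGauss308`; modifies nothing.  NOT summit progress; NOT
continuum; NOT Clay.  Cell `lit-balaban` Phase 2, seat p36 gen 12 (owner r16, referee ref-5).
-/

noncomputable section

namespace Literature.MathematicalPhysics.QuantumFieldTheory.BalabanImbrieJaffe1984to88.BIJ88EffectiveActionNoncentred308

open Finset MeasureTheory ProbabilityTheory Matrix Filter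
open scoped Topology
open Literature.Probability.LatticeModels (setPartitions ursellOf)
open BIJ88Sect2Statements (pLog)
open BIJ88PolymerRep5134 (corner)
open BIJ88PolymerRep5134Gauss (ext prec src zG)
open BIJ88Expansion5143 (g3 prime)
open BIJ88Expansion5143Gauss (fD)
open BIJ88Expansion5143Ordered (polysOf cvsupp locv wv)
open BIJ88ConnectedGraphResummation (Tsum)
open BIJ88SlotMoments308 (zt slotMoment zt_eq zt_zero measurable_sumV abs_sumV_le remR_sum_trunc_eq_zt succ_mul_remR)
open BIJ88SlotMomentsGauss308 (fieldLaw uD measurable_ext continuous_ext isProbabilityMeasure_fieldLaw zt_fieldLaw_eq_zG zG_fD_empty_pos)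
open BIJ88SlotCumulants308 (slotMoment_eq_sum_setPartitions_ursell ursell_slotMoment_fieldLaw_eq_Tsum_of_ineq5144)
open BIJ88SlotConnectedGraph310KP (abs_remR_sum_Tsum_le_of_ineq5144)
open BIJ88EffectiveActionGauss308 (hasGaussianLaw_slotFields measurable_slotField remR_congr_Ioc)
open BIJ88RestrictionsL1Decay308 (contDiffOn_Icc_log_restrictedInteraction_of_L1 pertP_restrictedInteraction_of_L1)
open BIJ88GaussShellNoncentred309 (tendsto_integral_abs_iteratedDeriv_prod_cutoff_t_zero_of_hasGaussianLaw
  tendsto_integral_abs_iteratedDeriv_prod_cutoff_t_zero_of_joint integral_restrictedInteraction_pos_of_mean)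
open BIJ88Ineq5113Covering (cubeSys)
open BIJ88Sect5Statements (CutoffProfile cutoff)
open BIJ88Sect5StatementsPart2 (Ineq5144)
open BIJ88Sect5StatementsPart4 (remR pertP taylor_logz)
open BIJ88Perturbative341 (pertPart)

/-! ## §1 The p. 308 family on a probability space: the `t = 0` end with the Gaussian inputs explicit, under `hL1`, and for non-centred fields -/

section Abstract

variable (χ : CutoffProfile) {ι υ Ω : Type*} [MeasurableSpace Ω] [DecidableEq ι] [DecidableEq υ]
  {p ek : ℝ} {B : Finset ι} {Φ : ι → Ω → ℝ} {c : ι → ℝ} {Ys : Finset υ} {V : υ → Ω → ℝ}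

omit [DecidableEq ι] [DecidableEq υ] in
/-- **`log z ∈ Cⁿ([0,1])` for the p. 308 family under the L¹ hypothesis** (probability measure, measurable fields, `c_b ≥ c₀ > 0`, `p > 0`, measurable
`|V_Y| ≤ K_Y`, `0 < e_k < e^{−1}`, `z_t ≠ 0` on `(0,1]`, `hL1 : ∀ i ≥ 1, ∫|(∂/∂t)ⁱχ′_{Λ,t}| dP → 0`): this generation's
`BIJ88RestrictionsL1Decay308.contDiffOn_Icc_log_restrictedInteraction_of_L1` with `W = Σ_Y V_Y`. [cite: BalabanImbrieJaffe1988, (5.14.2) p.308] -/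
theorem contDiffOn_uIcc_log_zt_of_L1 (hp : 0 < p) (P : Measure Ω) [IsProbabilityMeasure P] (hΦ : ∀ b ∈ B, Measurable (Φ b))
    {c₀ : ℝ} (hc₀ : 0 < c₀) (hcb : ∀ b ∈ B, c₀ ≤ c b) (hV : ∀ Y ∈ Ys, Measurable (V Y)) {KY : υ → ℝ}
    (hK : ∀ Y ∈ Ys, ∀ ω, |V Y ω| ≤ KY Y) (hek : 0 < ek) (hek1 : ek < Real.exp (-1))
    (hz : ∀ t ∈ Set.Ioc (0 : ℝ) 1, zt χ p ek B Φ c Ys V P t ≠ 0)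
    (hL1 : ∀ i, 1 ≤ i → Tendsto (fun t => ∫ ω, |iteratedDeriv i (fun s => ∏ b ∈ B, cutoff χ (c b * pLog p (s * ek)) (Φ b ω)) t| ∂P)
      (𝓝[>] (0 : ℝ)) (𝓝 0)) (n : ℕ) :
    ContDiffOn ℝ n (fun x => Real.log (zt χ p ek B Φ c Ys V P x)) (Set.uIcc 0 1) := by
  have hz' : ∀ t ∈ Set.Ioc (0 : ℝ) 1, (∫ ω, (∏ b ∈ B, cutoff χ (c b * pLog p (t * ek)) (Φ b ω)) *
      Real.exp (-(t * ∑ Y ∈ Ys, V Y ω)) ∂P) ≠ 0 := fun t ht => by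
    have h := hz t ht; rwa [zt_eq] at h
  rw [zt_eq, Set.uIcc_of_le zero_le_one]
  exact contDiffOn_Icc_log_restrictedInteraction_of_L1 χ hp P B hΦ hc₀ hcb (measurable_sumV hV) (abs_sumV_le hK) hek hek1 hz' hL1 n

/-- **(5.14.1)–(5.14.2) for the p. 308 family in the `Σ_γ` form WITH THE TWO ANALYTIC INPUTS EXPLICIT** — `z_t > 0` on `(0,1]` and
`log z ∈ C^{n̄+1}([0,1])` — for ANY probability measure (`p ≠ 0`, measurable fields, `c_b ≠ 0`, measurable `|V_Y| ≤ K_Y`, `0 < e_k < e^{−1}`,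
`|L| = n̄+1`) and ANY solution `κ_t(·,γ)` of p. 310 display 2 per assignment: `−log z₁ = 𝒫̃_{k+1} + (n̄+1)·remR(Σ_γ κ_t) = 𝒫̃_{k+1} + ∫₀¹ −((1−t)^{n̄}/n̄!) Σ_γ κ_t dt`
(gen 10's `BIJ88SlotMoments308.effectiveAction_eq_pertP_add_sum_slotTrunc` with the Gaussian structure abstracted into the two inputs; `(n̄+1)!` slip
GAPS G-C2-p36-06). [cite: BalabanImbrieJaffe1988, (5.14.1)–(5.14.2) p.308; p.310 display 2] -/
theorem effectiveAction_eq_pertP_add_sum_slotTrunc_of_contDiffOn (hp : p ≠ 0) (P : Measure Ω) [IsProbabilityMeasure P]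
    (hΦ : ∀ b ∈ B, Measurable (Φ b)) (hc : ∀ b ∈ B, c b ≠ 0) (hV : ∀ Y ∈ Ys, Measurable (V Y)) {KY : υ → ℝ}
    (hK : ∀ Y ∈ Ys, ∀ ω, |V Y ω| ≤ KY Y) (hek : 0 < ek) (hek1 : ek < Real.exp (-1))
    (hzpos : ∀ x ∈ Set.Ioc (0 : ℝ) 1, 0 < zt χ p ek B Φ c Ys V P x)
    {α : Type*} [Fintype α] [DecidableEq α] {nbar : ℕ} (hα : Fintype.card α = nbar + 1)
    (hcd : ContDiffOn ℝ (nbar + 1 : ℕ) (fun x => Real.log (zt χ p ek B Φ c Ys V P x)) (Set.uIcc 0 1)) (s₀ : ↥B ⊕ ↥Ys)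
    {κ : ℝ → Finset α → (α → ↥B ⊕ ↥Ys) → ℝ}
    (hκ : ∀ t ∈ Set.Ioc (0 : ℝ) 1, ∀ γ, ∀ K : Finset α, K.Nonempty →
      slotMoment χ p ek B Φ c Ys V P t K γ = ∑ π ∈ setPartitions K, ∏ A ∈ π, κ t A γ) :
    -Real.log (zt χ p ek B Φ c Ys V P 1) = pertP (fun t => Real.log (zt χ p ek B Φ c Ys V P t)) nbar
        + (nbar + 1 : ℝ) * remR (fun t => ∑ γ : α → ↥B ⊕ ↥Ys, κ t Finset.univ γ) nbar ∧
      -Real.log (zt χ p ek B Φ c Ys V P 1) = pertP (fun t => Real.log (zt χ p ek B Φ c Ys V P t)) nbar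
        + ∫ t in (0 : ℝ)..1, -((1 - t) ^ nbar / nbar.factorial) * ∑ γ : α → ↥B ⊕ ↥Ys, κ t Finset.univ γ := by
  have hR := remR_sum_trunc_eq_zt χ P hΦ hc hV hK hek hek1 hzpos hα s₀ hκ
  have hT := taylor_logz (nbar := nbar) hcd
  rw [zt_zero χ hp P, Real.log_one, zero_sub] at hT
  rw [← succ_mul_remR]
  have hn : ((nbar : ℝ) + 1) ≠ 0 := Nat.cast_add_one_ne_zero nbar
  refine ⟨?_, ?_⟩ <;>
  · rw [hT, hR]
    field_simp
    ring

/-- **The same with `⟨…;…⟩_t := THE CUMULANTS`** (Ruelle's `ursellOf` of the slot moments inhabits display 2, gen 11's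
`BIJ88SlotCumulants308.slotMoment_eq_sum_setPartitions_ursell`): `−log z₁ = 𝒫̃_{k+1} + (n̄+1)·remR(t ↦ Σ_γ uᵀ_{γ,t}(L))` and the `∫₀¹` form, given
`z_t > 0` on `(0,1]` and `log z ∈ C^{n̄+1}([0,1])`. [cite: BalabanImbrieJaffe1988, (5.14.1)–(5.14.2) p.308; p.310 display 2] -/
theorem effectiveAction_eq_pertP_add_remR_ursell_of_contDiffOn (hp : p ≠ 0) (P : Measure Ω) [IsProbabilityMeasure P]
    (hΦ : ∀ b ∈ B, Measurable (Φ b)) (hc : ∀ b ∈ B, c b ≠ 0) (hV : ∀ Y ∈ Ys, Measurable (V Y)) {KY : υ → ℝ}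
    (hK : ∀ Y ∈ Ys, ∀ ω, |V Y ω| ≤ KY Y) (hek : 0 < ek) (hek1 : ek < Real.exp (-1))
    (hzpos : ∀ x ∈ Set.Ioc (0 : ℝ) 1, 0 < zt χ p ek B Φ c Ys V P x)
    {α : Type*} [Fintype α] [DecidableEq α] {nbar : ℕ} (hα : Fintype.card α = nbar + 1)
    (hcd : ContDiffOn ℝ (nbar + 1 : ℕ) (fun x => Real.log (zt χ p ek B Φ c Ys V P x)) (Set.uIcc 0 1)) (s₀ : ↥B ⊕ ↥Ys) :
    -Real.log (zt χ p ek B Φ c Ys V P 1) = pertP (fun t => Real.log (zt χ p ek B Φ c Ys V P t)) nbar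
        + (nbar + 1 : ℝ) * remR (fun t => ∑ γ : α → ↥B ⊕ ↥Ys, ursellOf (fun K' => slotMoment χ p ek B Φ c Ys V P t K' γ) univ) nbar ∧
      -Real.log (zt χ p ek B Φ c Ys V P 1) = pertP (fun t => Real.log (zt χ p ek B Φ c Ys V P t)) nbar
        + ∫ t in (0 : ℝ)..1, -((1 - t) ^ nbar / nbar.factorial) *
          ∑ γ : α → ↥B ⊕ ↥Ys, ursellOf (fun K' => slotMoment χ p ek B Φ c Ys V P t K' γ) univ :=
  effectiveAction_eq_pertP_add_sum_slotTrunc_of_contDiffOn χ hp P hΦ hc hV hK hek hek1 hzpos hα hcd s₀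
    (κ := fun t A γ => ursellOf (fun K' => slotMoment χ p ek B Φ c Ys V P t K' γ) A)
    fun t _ γ _ hK' => slotMoment_eq_sum_setPartitions_ursell χ P t γ hK'

/-- **(5.14.1)–(5.14.2) at the `t = 0` end UNDER THE L¹ HYPOTHESIS** (p. 309 *"After integration over A^{(k)}, we obtain factors ct^{−n}e^{−cp(te_k)²}"*
as `hL1`; probability measure, `p > 0`, measurable fields, `c_b ≥ c₀ > 0`, measurable `|V_Y| ≤ K_Y`, `0 < e_k < e^{−1}`, `z_t > 0` on `(0,1]`,
`|L| = n̄+1`); conclusion with the cumulants. [cite: BalabanImbrieJaffe1988, (5.14.1)–(5.14.2) p.308; p.309 (Sect. 5.14)] -/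
theorem effectiveAction_eq_pertP_add_remR_ursell_of_L1 (hp : 0 < p) (P : Measure Ω) [IsProbabilityMeasure P]
    (hΦ : ∀ b ∈ B, Measurable (Φ b)) {c₀ : ℝ} (hc₀ : 0 < c₀) (hcb : ∀ b ∈ B, c₀ ≤ c b) (hV : ∀ Y ∈ Ys, Measurable (V Y))
    {KY : υ → ℝ} (hK : ∀ Y ∈ Ys, ∀ ω, |V Y ω| ≤ KY Y) (hek : 0 < ek) (hek1 : ek < Real.exp (-1))
    (hzpos : ∀ x ∈ Set.Ioc (0 : ℝ) 1, 0 < zt χ p ek B Φ c Ys V P x)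
    (hL1 : ∀ i, 1 ≤ i → Tendsto (fun t => ∫ ω, |iteratedDeriv i (fun s => ∏ b ∈ B, cutoff χ (c b * pLog p (s * ek)) (Φ b ω)) t| ∂P)
      (𝓝[>] (0 : ℝ)) (𝓝 0)) {α : Type*} [Fintype α] [DecidableEq α] {nbar : ℕ} (hα : Fintype.card α = nbar + 1) (s₀ : ↥B ⊕ ↥Ys) :
    -Real.log (zt χ p ek B Φ c Ys V P 1) = pertP (fun t => Real.log (zt χ p ek B Φ c Ys V P t)) nbar
        + (nbar + 1 : ℝ) * remR (fun t => ∑ γ : α → ↥B ⊕ ↥Ys, ursellOf (fun K' => slotMoment χ p ek B Φ c Ys V P t K' γ) univ) nbar ∧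
      -Real.log (zt χ p ek B Φ c Ys V P 1) = pertP (fun t => Real.log (zt χ p ek B Φ c Ys V P t)) nbar
        + ∫ t in (0 : ℝ)..1, -((1 - t) ^ nbar / nbar.factorial) *
          ∑ γ : α → ↥B ⊕ ↥Ys, ursellOf (fun K' => slotMoment χ p ek B Φ c Ys V P t K' γ) univ :=
  effectiveAction_eq_pertP_add_remR_ursell_of_contDiffOn χ hp.ne' P hΦ (fun b hb => (hc₀.trans_le (hcb b hb)).ne') hV hK hek hek1 hzpos hα
    (contDiffOn_uIcc_log_zt_of_L1 χ hp P hΦ hc₀ hcb hV hK hek hek1 (fun t ht => (hzpos t ht).ne') hL1 (nbar + 1)) s₀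

/-- **(5.14.1)–(5.14.2) at the `t = 0` end FOR FIELDS WITH GAUSSIAN LAWS OF ANY MEANS** (p. 308: *"at which point we have a purely Gaussian
expectation"*; p. 305: *"Recall that we have a linear term in the measure, ⟨Φ,ℱ⟩"*): probability measure, `p > 1/2`, measurable fields with Gaussian
laws (Mathlib `HasGaussianLaw`; NO centring, no variance hypothesis), `c_b ≥ c₀ > 0`, measurable `|V_Y| ≤ K_Y`, `0 < e_k < e^{−1}`, `z_t > 0` on
`(0,1]`, `|L| = n̄+1`: `−log z₁ = 𝒫̃_{k+1} + (n̄+1)·remR(t ↦ Σ_γ uᵀ_{γ,t}(L)) = 𝒫̃_{k+1} + ∫₀¹ −((1−t)^{n̄}/n̄!) Σ_γ uᵀ_{γ,t}(L) dt` (`hL1` from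
`BIJ88GaussShellNoncentred309`). [cite: BalabanImbrieJaffe1988, (5.14.1)–(5.14.2) p.308] -/
theorem effectiveAction_eq_pertP_add_remR_ursell_of_hasGaussianLaw (hp : 1 / 2 < p) (P : Measure Ω) [IsProbabilityMeasure P]
    (hG : ∀ b ∈ B, HasGaussianLaw (Φ b) P) (hΦ : ∀ b ∈ B, Measurable (Φ b)) {c₀ : ℝ} (hc₀ : 0 < c₀) (hcb : ∀ b ∈ B, c₀ ≤ c b)
    (hV : ∀ Y ∈ Ys, Measurable (V Y)) {KY : υ → ℝ} (hK : ∀ Y ∈ Ys, ∀ ω, |V Y ω| ≤ KY Y) (hek : 0 < ek) (hek1 : ek < Real.exp (-1))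
    (hzpos : ∀ x ∈ Set.Ioc (0 : ℝ) 1, 0 < zt χ p ek B Φ c Ys V P x)
    {α : Type*} [Fintype α] [DecidableEq α] {nbar : ℕ} (hα : Fintype.card α = nbar + 1) (s₀ : ↥B ⊕ ↥Ys) :
    -Real.log (zt χ p ek B Φ c Ys V P 1) = pertP (fun t => Real.log (zt χ p ek B Φ c Ys V P t)) nbar
        + (nbar + 1 : ℝ) * remR (fun t => ∑ γ : α → ↥B ⊕ ↥Ys, ursellOf (fun K' => slotMoment χ p ek B Φ c Ys V P t K' γ) univ) nbar ∧
      -Real.log (zt χ p ek B Φ c Ys V P 1) = pertP (fun t => Real.log (zt χ p ek B Φ c Ys V P t)) nbar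
        + ∫ t in (0 : ℝ)..1, -((1 - t) ^ nbar / nbar.factorial) *
          ∑ γ : α → ↥B ⊕ ↥Ys, ursellOf (fun K' => slotMoment χ p ek B Φ c Ys V P t K' γ) univ :=
  effectiveAction_eq_pertP_add_remR_ursell_of_L1 χ (by linarith) P hΦ hc₀ hcb hV hK hek hek1 hzpos
    (fun _ hi => tendsto_integral_abs_iteratedDeriv_prod_cutoff_t_zero_of_hasGaussianLaw χ hp P B hG hΦ hc₀
      (fun b hb => (hcb b hb).trans (le_abs_self _)) hek hi) hα s₀

/-- **(5.14.1)–(5.14.2) at the `t = 0` end FOR NON-CENTRED JOINTLY GAUSSIAN FIELDS WITH MEANS IN THE SMALL-FIELD BOX, NO STANDING HYPOTHESIS**: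
`χ ≥ 0`, `p > 1/2`, jointly Gaussian measurable fields (`HasGaussianLaw` of `ω ↦ (Φ_b ω)_{b∈Λ}`) with `|E Φ_b| < (9/10)c₀`, `c_b ≥ c₀ > 0`,
measurable `|V_Y| ≤ K_Y`, `0 < e_k < e^{−1}`, `|L| = n̄+1`: the conclusion of gen 11's `BIJ88SlotCumulants308.effectiveAction_eq_pertP_add_remR_ursell`
with its centring `h0` replaced by the box condition (`z_t > 0` by `BIJ88GaussShellNoncentred309.integral_restrictedInteraction_pos_of_mean`).
[cite: BalabanImbrieJaffe1988, (5.14.1)–(5.14.2) p.308] -/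
theorem effectiveAction_eq_pertP_add_remR_ursell_of_mean (hχ : ∀ x, 0 ≤ χ.χ₁ x) (hp : 1 / 2 < p) (P : Measure Ω)
    [IsProbabilityMeasure P] (hJ : HasGaussianLaw (fun ω (b : B) => Φ b ω) P) (hΦ : ∀ b ∈ B, Measurable (Φ b)) {c₀ : ℝ}
    (hc₀ : 0 < c₀) (hcb : ∀ b ∈ B, c₀ ≤ c b) (hm : ∀ b ∈ B, |P[Φ b]| < 9 / 10 * c₀) (hV : ∀ Y ∈ Ys, Measurable (V Y))
    {KY : υ → ℝ} (hK : ∀ Y ∈ Ys, ∀ ω, |V Y ω| ≤ KY Y) (hek : 0 < ek) (hek1 : ek < Real.exp (-1))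
    {α : Type*} [Fintype α] [DecidableEq α] {nbar : ℕ} (hα : Fintype.card α = nbar + 1) (s₀ : ↥B ⊕ ↥Ys) :
    -Real.log (zt χ p ek B Φ c Ys V P 1) = pertP (fun t => Real.log (zt χ p ek B Φ c Ys V P t)) nbar
        + (nbar + 1 : ℝ) * remR (fun t => ∑ γ : α → ↥B ⊕ ↥Ys, ursellOf (fun K' => slotMoment χ p ek B Φ c Ys V P t K' γ) univ) nbar ∧
      -Real.log (zt χ p ek B Φ c Ys V P 1) = pertP (fun t => Real.log (zt χ p ek B Φ c Ys V P t)) nbar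
        + ∫ t in (0 : ℝ)..1, -((1 - t) ^ nbar / nbar.factorial) *
          ∑ γ : α → ↥B ⊕ ↥Ys, ursellOf (fun K' => slotMoment χ p ek B Φ c Ys V P t K' γ) univ := by
  refine effectiveAction_eq_pertP_add_remR_ursell_of_hasGaussianLaw χ hp P (BIJ88ZtPositivity308.hasGaussianLaw_of_joint P B hJ) hΦ hc₀
    hcb hV hK hek hek1 (fun t ht => ?_) hα s₀
  rw [zt_eq]
  exact integral_restrictedInteraction_pos_of_mean χ hχ (by linarith) P B hJ hΦ hc₀ hcb hm (measurable_sumV hV) (abs_sumV_le hK) hek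
    ht.1 (BIJ88ZtPositivity308.mul_le_exp_neg_one_of_Ioc hek hek1.le ht)

omit [DecidableEq ι] [DecidableEq υ] in
/-- **Print's `𝒫̃_{k+1}` for the family = the cumulant sum of `−Ṽ` in the `t = 0` measure, under `hL1`**: `pertP (log z) n̄ = pertPart n̄ (cgf_{−Ṽ})`,
`Ṽ = Σ_Y V_Y` (hypotheses of `contDiffOn_uIcc_log_zt_of_L1`). [cite: BalabanImbrieJaffe1988, (5.14.1) p.308] -/
theorem pertP_log_zt_eq_pertPart_cgf_of_L1 (hp : 0 < p) (P : Measure Ω) [IsProbabilityMeasure P] (hΦ : ∀ b ∈ B, Measurable (Φ b))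
    {c₀ : ℝ} (hc₀ : 0 < c₀) (hcb : ∀ b ∈ B, c₀ ≤ c b) (hV : ∀ Y ∈ Ys, Measurable (V Y)) {KY : υ → ℝ}
    (hK : ∀ Y ∈ Ys, ∀ ω, |V Y ω| ≤ KY Y) (hek : 0 < ek) (hek1 : ek < Real.exp (-1))
    (hz : ∀ t ∈ Set.Ioc (0 : ℝ) 1, zt χ p ek B Φ c Ys V P t ≠ 0)
    (hL1 : ∀ i, 1 ≤ i → Tendsto (fun t => ∫ ω, |iteratedDeriv i (fun s => ∏ b ∈ B, cutoff χ (c b * pLog p (s * ek)) (Φ b ω)) t| ∂P)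
      (𝓝[>] (0 : ℝ)) (𝓝 0)) (nbar : ℕ) :
    pertP (fun t => Real.log (zt χ p ek B Φ c Ys V P t)) nbar = pertPart nbar (cgf (fun ω => -∑ Y ∈ Ys, V Y ω) P) := by
  have hz' : ∀ t ∈ Set.Ioc (0 : ℝ) 1, (∫ ω, (∏ b ∈ B, cutoff χ (c b * pLog p (t * ek)) (Φ b ω)) *
      Real.exp (-(t * ∑ Y ∈ Ys, V Y ω)) ∂P) ≠ 0 := fun t ht => by
    have h := hz t ht; rwa [zt_eq] at h
  rw [zt_eq]
  exact pertP_restrictedInteraction_of_L1 χ hp P B hΦ hc₀ hcb (measurable_sumV hV) (abs_sumV_le hK) hek hek1 hz' hL1 nbar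

end Abstract

/-! ## §2 The §5.13 Gaussian model: the `hcen`-free `t = 0` end -/

section Model

variable {α I : Type} [Fintype α] [DecidableEq α] [Fintype I] [DecidableEq I]
  (blk : α → I) (Δ : Matrix α α ℝ) (ℱ : α → ℝ) (W : Finset I) (adj : I → I → Prop) [DecidableRel adj] {nbr : I → Finset I} {D : ℕ}
variable (χ : CutoffProfile) {ι υ : Type*} [DecidableEq ι] [DecidableEq υ]
variable {p ek : ℝ} {B : Finset ι} {Φ : ι → (α → ℝ) → ℝ} {c : ι → ℝ} {Ys : Finset υ} {V : υ → (α → ℝ) → ℝ}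
variable (cube : ↥B ⊕ ↥Ys → I) {θ β' : ℝ} {L : Type} [Fintype L] [DecidableEq L]

omit [DecidableEq α] [Fintype I] [DecidableEq ι] in
/-- A linear slot field is continuous and vanishes at the zero configuration. [cite: BalabanImbrieJaffe1988, (5.14.2) p.308] -/
theorem continuous_and_zero_of_isLinearMap {b : ι} (hlin : IsLinearMap ℝ (Φ b)) : Continuous (Φ b) ∧ Φ b 0 = 0 :=
  ⟨LinearMap.continuous_of_finiteDimensional (hlin.mk' (Φ b)), (hlin.mk' (Φ b)).map_zero⟩

omit [DecidableEq ι] in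
/-- **`hL1` HOLDS IN THE MODEL**: for linear slot fields, `W`-block of `Δ` positive definite, `c_b ≥ c₀ > 0`, `p > 1/2`, `e_k > 0`, `i ≥ 1`:
`∫ |(∂/∂t)ⁱ Π_b χ(c_b p(te_k), Φ_b(ext ω))| dfieldLaw(ω) → 0` as `t → 0⁺` — the slot fields are jointly Gaussian with mean `Φ_b(ext Δ_W⁻¹ℱ_W)` (gen 11's
`hasGaussianLaw_slotFields`), and no centring is needed (`BIJ88GaussShellNoncentred309`). [cite: BalabanImbrieJaffe1988, p.309 (Sect. 5.14)] -/
theorem slotFields_L1 (hp : 1 / 2 < p) (hPD : (prec blk Δ W (corner ℝ W)).PosDef) (hlin : ∀ b ∈ B, IsLinearMap ℝ (Φ b))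
    {c₀ : ℝ} (hc₀ : 0 < c₀) (hcb : ∀ b ∈ B, c₀ ≤ c b) (hek : 0 < ek) :
    ∀ i, 1 ≤ i → Tendsto (fun t => ∫ ω, |iteratedDeriv i (fun s => ∏ b ∈ B, cutoff χ (c b * pLog p (s * ek)) (Φ b (ext blk W ω))) t|
      ∂(fieldLaw blk Δ ℱ W)) (𝓝[>] (0 : ℝ)) (𝓝 0) := by
  haveI := isProbabilityMeasure_fieldLaw blk Δ ℱ W hPD
  exact tendsto_integral_abs_iteratedDeriv_prod_cutoff_t_zero_of_joint χ hp (fieldLaw blk Δ ℱ W) B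
    (hasGaussianLaw_slotFields blk Δ ℱ W hPD hlin) (fun b hb => measurable_slotField blk W (hlin b hb)) hc₀ hcb hek

omit [Fintype L] [DecidableEq L] in
/-- **`log z_t ∈ Cⁿ([0,1])` IN THE MODEL, NO CENTRING** (`χ ≥ 0`, `p > 1/2`, `W`-block positive definite, cubes of the slots in `W`, linear slot fields,
`c_b ≥ c₀ > 0`, measurable bounded terms, `0 < e_k < e^{−1}`), `z_t = zG blk Δ ℱ (fD_t γ₀ ∅) W W`: positivity is structural (gen 10's `zG_fD_empty_pos`),
`hL1` is `slotFields_L1`. [cite: BalabanImbrieJaffe1988, (5.14.2) p.308] -/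
theorem contDiffOn_uIcc_log_zG (hχ : ∀ x, 0 ≤ χ.χ₁ x) (hp : 1 / 2 < p) (hPD : (prec blk Δ W (corner ℝ W)).PosDef)
    (hcube : ∀ τ, cube τ ∈ W) (hlin : ∀ b ∈ B, IsLinearMap ℝ (Φ b)) {c₀ : ℝ} (hc₀ : 0 < c₀) (hcb : ∀ b ∈ B, c₀ ≤ c b)
    (hV : ∀ Y ∈ Ys, Measurable (V Y)) {KY : υ → ℝ} (hK : ∀ Y ∈ Ys, ∀ φ, |V Y φ| ≤ KY Y) (hek : 0 < ek) (hek1 : ek < Real.exp (-1))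
    (γ₀ : L → ↥B ⊕ ↥Ys) (n : ℕ) :
    ContDiffOn ℝ n (fun x => Real.log (zG blk Δ ℱ (fD (uD χ p ek B Φ c Ys V x) cube γ₀ ∅) W W)) (Set.uIcc 0 1) := by
  haveI := isProbabilityMeasure_fieldLaw blk Δ ℱ W hPD
  have hz : ∀ t, zt χ p ek B (fun b ω => Φ b (ext blk W ω)) c Ys (fun Y ω => V Y (ext blk W ω)) (fieldLaw blk Δ ℱ W) t =
      zG blk Δ ℱ (fD (uD χ p ek B Φ c Ys V t) cube γ₀ ∅) W W := fun t =>
    zt_fieldLaw_eq_zG blk Δ ℱ W χ p ek B Φ c Ys V cube hcube γ₀ t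
  have h := contDiffOn_uIcc_log_zt_of_L1 χ (by linarith : 0 < p) (fieldLaw blk Δ ℱ W) (Φ := fun b ω => Φ b (ext blk W ω)) (c := c)
    (Ys := Ys) (V := fun Y ω => V Y (ext blk W ω)) (fun b hb => measurable_slotField blk W (hlin b hb)) hc₀ hcb
    (fun Y hY => (hV Y hY).comp (measurable_ext blk W)) (KY := KY) (fun Y hY ω => hK Y hY _) hek hek1
    (fun t ht => by
      rw [hz]
      exact (zG_fD_empty_pos blk Δ ℱ W χ cube hχ (by linarith) hPD hcube (fun b hb => (continuous_and_zero_of_isLinearMap (hlin b hb)).1)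
        (fun b hb => (continuous_and_zero_of_isLinearMap (hlin b hb)).2) hc₀ hcb hV hK hek γ₀ ht.1
        (BIJ88ZtPositivity308.mul_le_exp_neg_one_of_Ioc hek hek1.le ht)).ne')
    (slotFields_L1 blk Δ ℱ W χ hp hPD hlin hc₀ hcb hek) n
  simpa only [hz] using h

/-- **(5.14.1)–(5.14.2) AT THE `t = 0` END IN THE §5.13 GAUSSIAN MODEL — NO CENTRING** (p. 308: *"the restrictions and the interactions disappear at
t = 0, at which point we have a purely Gaussian expectation …"*; p. 304: *"(1/N)∫dΦ … exp[½⟨Φ,ΔΦ⟩ + ⟨Φ,ℱ⟩]"* (sic, sign as printed)): in the law `fieldLaw blk Δ ℱ W` of (5.14.3)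
(`W`-block of `Δ` positive definite, ANY source `ℱ`), for LINEAR slot fields `Φ_b`, cubes of the slots in `W`, `χ ≥ 0`, `p > 1/2`, `c_b ≥ c₀ > 0`,
measurable bounded terms `|V_Y| ≤ K_Y`, `0 < e_k < e^{−1}`, `|L| = n̄+1` labels: with `z_t := zG blk Δ ℱ (fD_t γ₀ ∅) W W` (`z₀ = 1`) and `uᵀ_{γ,t}` the
Ursell cumulants of the slot moments, `−log z₁ = 𝒫̃_{k+1} + (n̄+1)·remR(t ↦ Σ_{γ : L → slots} uᵀ_{γ,t}(L))` and
`−log z₁ = 𝒫̃_{k+1} + ∫₀¹ −((1−t)^{n̄}/n̄!) Σ_γ uᵀ_{γ,t}(L) dt` — gen 11's `BIJ88EffectiveActionGauss308.effectiveAction_fieldLaw_eq_pertP_add_remR_ursell`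
with `hcen` DELETED. [cite: BalabanImbrieJaffe1988, (5.14.1)–(5.14.2) p.308] -/
theorem effectiveAction_fieldLaw_eq_pertP_add_remR_ursell' (hχ : ∀ x, 0 ≤ χ.χ₁ x) (hp : 1 / 2 < p)
    (hPD : (prec blk Δ W (corner ℝ W)).PosDef) (hcube : ∀ τ, cube τ ∈ W) (hlin : ∀ b ∈ B, IsLinearMap ℝ (Φ b))
    {c₀ : ℝ} (hc₀ : 0 < c₀) (hcb : ∀ b ∈ B, c₀ ≤ c b) (hV : ∀ Y ∈ Ys, Measurable (V Y)) {KY : υ → ℝ}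
    (hK : ∀ Y ∈ Ys, ∀ φ, |V Y φ| ≤ KY Y) (hek : 0 < ek) (hek1 : ek < Real.exp (-1)) {nbar : ℕ} (hL : Fintype.card L = nbar + 1)
    (s₀ : ↥B ⊕ ↥Ys) (γ₀ : L → ↥B ⊕ ↥Ys) :
    -Real.log (zG blk Δ ℱ (fD (uD χ p ek B Φ c Ys V 1) cube γ₀ ∅) W W) =
        pertP (fun t => Real.log (zG blk Δ ℱ (fD (uD χ p ek B Φ c Ys V t) cube γ₀ ∅) W W)) nbar
          + (nbar + 1 : ℝ) * remR (fun t => ∑ γ : L → ↥B ⊕ ↥Ys, ursellOf (fun K' => slotMoment χ p ek B (fun b ω => Φ b (ext blk W ω)) c Ys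
              (fun Y ω => V Y (ext blk W ω)) (fieldLaw blk Δ ℱ W) t K' γ) univ) nbar ∧
      -Real.log (zG blk Δ ℱ (fD (uD χ p ek B Φ c Ys V 1) cube γ₀ ∅) W W) =
        pertP (fun t => Real.log (zG blk Δ ℱ (fD (uD χ p ek B Φ c Ys V t) cube γ₀ ∅) W W)) nbar
          + ∫ t in (0 : ℝ)..1, -((1 - t) ^ nbar / nbar.factorial) *
              ∑ γ : L → ↥B ⊕ ↥Ys, ursellOf (fun K' => slotMoment χ p ek B (fun b ω => Φ b (ext blk W ω)) c Ys
                (fun Y ω => V Y (ext blk W ω)) (fieldLaw blk Δ ℱ W) t K' γ) univ := by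
  haveI := isProbabilityMeasure_fieldLaw blk Δ ℱ W hPD
  have hz : ∀ t, zt χ p ek B (fun b ω => Φ b (ext blk W ω)) c Ys (fun Y ω => V Y (ext blk W ω)) (fieldLaw blk Δ ℱ W) t =
      zG blk Δ ℱ (fD (uD χ p ek B Φ c Ys V t) cube γ₀ ∅) W W := fun t =>
    zt_fieldLaw_eq_zG blk Δ ℱ W χ p ek B Φ c Ys V cube hcube γ₀ t
  have hzpos : ∀ t ∈ Set.Ioc (0 : ℝ) 1, 0 < zt χ p ek B (fun b ω => Φ b (ext blk W ω)) c Ys (fun Y ω => V Y (ext blk W ω))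
      (fieldLaw blk Δ ℱ W) t := fun t ht => by
    rw [hz]
    exact zG_fD_empty_pos blk Δ ℱ W χ cube hχ (by linarith) hPD hcube (fun b hb => (continuous_and_zero_of_isLinearMap (hlin b hb)).1)
      (fun b hb => (continuous_and_zero_of_isLinearMap (hlin b hb)).2) hc₀ hcb hV hK hek γ₀ ht.1
      (BIJ88ZtPositivity308.mul_le_exp_neg_one_of_Ioc hek hek1.le ht)
  have h := effectiveAction_eq_pertP_add_remR_ursell_of_hasGaussianLaw χ hp (fieldLaw blk Δ ℱ W) (Φ := fun b ω => Φ b (ext blk W ω))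
    (c := c) (Ys := Ys) (V := fun Y ω => V Y (ext blk W ω))
    (BIJ88ZtPositivity308.hasGaussianLaw_of_joint _ B (hasGaussianLaw_slotFields blk Δ ℱ W hPD hlin))
    (fun b hb => measurable_slotField blk W (hlin b hb)) hc₀ hcb (fun Y hY => (hV Y hY).comp (measurable_ext blk W)) (KY := KY)
    (fun Y hY ω => hK Y hY _) hek hek1 hzpos hL s₀
  simpa only [hz] using h

/-- **(5.14.1)–(5.14.2) IN THE MODEL WITH THE REMAINDER AS THE CONNECTED-GRAPH SERIES, MODULO (5.14.4) — NO CENTRING** (p. 310: *"It is now a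
standard exercise to estimate the expansion, using (5.14.4)"*): hypotheses of `effectiveAction_fieldLaw_eq_pertP_add_remR_ursell'` plus `Δ` coupling
abutting cubes only, cube-local fields and terms, and the typed leaf (5.14.4) for the prime-dropped activities of every assignment at every `t ∈ (0,1]` in
gen 5's regime: `−log z₁ = 𝒫̃_{k+1} + (n̄+1)·remR(t ↦ Σ_γ T_{γ,t}(L))` and the `∫₀¹` form, `T` = p25's `Tsum` of display 3 over the virtual supports (gen 11's
`…_Tsum_of_ineq5144` with `hcen` DELETED). [cite: BalabanImbrieJaffe1988, (5.14.1)–(5.14.2) p.308; p.310 display 3; (5.14.4) p.309] -/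
theorem effectiveAction_fieldLaw_eq_pertP_add_remR_Tsum_of_ineq5144' (hR : ∀ x y, adj x y → adj y x) (hD : ∀ x, (nbr x).card ≤ D)
    (hnbr : ∀ x y, adj x y → y ∈ nbr x) (hθ0 : 0 < θ) (hθ1 : θ ≤ 1) (hβ : 0 ≤ β')
    (hsmall : 16 * ((D : ℝ) + 1) ^ 2 * (θ ^ (β' / 2) * Real.exp 2) ≤ 1) (hχ : ∀ x, 0 ≤ χ.χ₁ x) (hp : 1 / 2 < p)
    (hΔ : ∀ x y, blk x ≠ blk y → ¬ adj (blk x) (blk y) → Δ x y = 0) (hPD : (prec blk Δ W (corner ℝ W)).PosDef)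
    (hcube : ∀ τ, cube τ ∈ W)
    (hΦloc : ∀ b : B, ∀ φ ψ : α → ℝ, (∀ x, blk x = cube (Sum.inl b) → φ x = ψ x) → Φ b φ = Φ b ψ)
    (hVloc : ∀ Y : Ys, ∀ φ ψ : α → ℝ, (∀ x, blk x = cube (Sum.inr Y) → φ x = ψ x) → V Y φ = V Y ψ)
    (hlin : ∀ b ∈ B, IsLinearMap ℝ (Φ b)) {c₀ : ℝ} (hc₀ : 0 < c₀) (hcb : ∀ b ∈ B, c₀ ≤ c b) (hV : ∀ Y ∈ Ys, Measurable (V Y))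
    {KY : υ → ℝ} (hK : ∀ Y ∈ Ys, ∀ φ, |V Y φ| ≤ KY Y) (hek : 0 < ek) (hek1 : ek < Real.exp (-1)) {nbar : ℕ}
    (hL : Fintype.card L = nbar + 1) (s₀ : ↥B ⊕ ↥Ys) (γ₀ : L → ↥B ⊕ ↥Ys)
    (h5144 : ∀ t ∈ Set.Ioc (0 : ℝ) 1, ∀ γ : L → ↥B ⊕ ↥Ys, Ineq5144 (cubeSys I) (Finset L)
      (prime (g3 adj fun H' => zG blk Δ ℱ (fD (uD χ p ek B Φ c Ys V t) cube γ H')))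
      Finset.card (fun H (X : Finset I) => (X \ H.image (cube ∘ γ)).card) θ β') :
    -Real.log (zG blk Δ ℱ (fD (uD χ p ek B Φ c Ys V 1) cube γ₀ ∅) W W) =
        pertP (fun t => Real.log (zG blk Δ ℱ (fD (uD χ p ek B Φ c Ys V t) cube γ₀ ∅) W W)) nbar
          + (nbar + 1 : ℝ) * remR (fun t => ∑ γ : L → ↥B ⊕ ↥Ys, Tsum ((polysOf W).image (cvsupp adj W)) (locv (cube ∘ γ))
              (wv (prime (g3 adj fun H' => zG blk Δ ℱ (fD (uD χ p ek B Φ c Ys V t) cube γ H')))) univ) nbar ∧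
      -Real.log (zG blk Δ ℱ (fD (uD χ p ek B Φ c Ys V 1) cube γ₀ ∅) W W) =
        pertP (fun t => Real.log (zG blk Δ ℱ (fD (uD χ p ek B Φ c Ys V t) cube γ₀ ∅) W W)) nbar
          + ∫ t in (0 : ℝ)..1, -((1 - t) ^ nbar / nbar.factorial) *
              ∑ γ : L → ↥B ⊕ ↥Ys, Tsum ((polysOf W).image (cvsupp adj W)) (locv (cube ∘ γ))
                (wv (prime (g3 adj fun H' => zG blk Δ ℱ (fD (uD χ p ek B Φ c Ys V t) cube γ H')))) univ := by
  haveI : Nonempty L := Fintype.card_pos_iff.1 (by omega)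
  obtain ⟨hA, -⟩ :=
    effectiveAction_fieldLaw_eq_pertP_add_remR_ursell' blk Δ ℱ W χ cube hχ hp hPD hcube hlin hc₀ hcb hV hK hek hek1 hL s₀ γ₀
  have hTs : ∀ t ∈ Set.Ioc (0 : ℝ) 1,
      ∑ γ : L → ↥B ⊕ ↥Ys, ursellOf (fun K' => slotMoment χ p ek B (fun b ω => Φ b (ext blk W ω)) c Ys
          (fun Y ω => V Y (ext blk W ω)) (fieldLaw blk Δ ℱ W) t K' γ) univ =
        ∑ γ : L → ↥B ⊕ ↥Ys, Tsum ((polysOf W).image (cvsupp adj W)) (locv (cube ∘ γ))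
          (wv (prime (g3 adj fun H' => zG blk Δ ℱ (fD (uD χ p ek B Φ c Ys V t) cube γ H')))) univ := fun t ht =>
    Finset.sum_congr rfl fun γ _ =>
      ursell_slotMoment_fieldLaw_eq_Tsum_of_ineq5144 blk Δ ℱ W adj χ cube hR hD hnbr hθ0 hθ1 hβ hsmall hΔ hcube hΦloc hVloc γ
        (h5144 t ht γ) Finset.univ_nonempty
  have hA' := (remR_congr_Ioc hTs nbar) ▸ hA
  exact ⟨hA', by rw [← succ_mul_remR]; exact hA'⟩

/-- **THE REMAINDER OF (5.14.2) IS `O(|W|)` WITH THE `(n̄+1)`-ST POWER OF THE VERTEX FACTOR, IN THE MODEL, MODULO (5.14.4) — NO CENTRING** (p. 310: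
*"The result is |W₆^{(k)′}(X)| ≤ (e^β(L^kε/ε₀)^{1/4−α})^{n̄+1+β′|X|}"*, globally): under the hypotheses of
`effectiveAction_fieldLaw_eq_pertP_add_remR_Tsum_of_ineq5144'`, `|−log z₁ − 𝒫̃_{k+1}| ≤ (n̄+1)·N_s^{n̄+1}·θ^{(1−β′)(n̄+1)}·2·(2e²θ^{β′}(D+1))·|W|`
(gen 11's `BIJ88SlotConnectedGraph310KP.abs_remR_sum_Tsum_le_of_ineq5144`). [cite: BalabanImbrieJaffe1988, (5.14.2) p.308; p.310 (Sect. 5.14); (5.14.4) p.309] -/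
theorem abs_effectiveAction_sub_pertP_le_of_ineq5144' (hR : ∀ x y, adj x y → adj y x) (hD : ∀ x, (nbr x).card ≤ D)
    (hnbr : ∀ x y, adj x y → y ∈ nbr x) (hθ0 : 0 < θ) (hθ1 : θ ≤ 1) (hβ : 0 ≤ β')
    (hsmall : 16 * ((D : ℝ) + 1) ^ 2 * (θ ^ (β' / 2) * Real.exp 2) ≤ 1) (hχ : ∀ x, 0 ≤ χ.χ₁ x) (hp : 1 / 2 < p)
    (hΔ : ∀ x y, blk x ≠ blk y → ¬ adj (blk x) (blk y) → Δ x y = 0) (hPD : (prec blk Δ W (corner ℝ W)).PosDef)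
    (hcube : ∀ τ, cube τ ∈ W)
    (hΦloc : ∀ b : B, ∀ φ ψ : α → ℝ, (∀ x, blk x = cube (Sum.inl b) → φ x = ψ x) → Φ b φ = Φ b ψ)
    (hVloc : ∀ Y : Ys, ∀ φ ψ : α → ℝ, (∀ x, blk x = cube (Sum.inr Y) → φ x = ψ x) → V Y φ = V Y ψ)
    (hlin : ∀ b ∈ B, IsLinearMap ℝ (Φ b)) {c₀ : ℝ} (hc₀ : 0 < c₀) (hcb : ∀ b ∈ B, c₀ ≤ c b) (hV : ∀ Y ∈ Ys, Measurable (V Y))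
    {KY : υ → ℝ} (hK : ∀ Y ∈ Ys, ∀ φ, |V Y φ| ≤ KY Y) (hek : 0 < ek) (hek1 : ek < Real.exp (-1)) {nbar : ℕ}
    (hL : Fintype.card L = nbar + 1) (s₀ : ↥B ⊕ ↥Ys) (γ₀ : L → ↥B ⊕ ↥Ys)
    (h5144 : ∀ t ∈ Set.Ioc (0 : ℝ) 1, ∀ γ : L → ↥B ⊕ ↥Ys, Ineq5144 (cubeSys I) (Finset L)
      (prime (g3 adj fun H' => zG blk Δ ℱ (fD (uD χ p ek B Φ c Ys V t) cube γ H')))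
      Finset.card (fun H (X : Finset I) => (X \ H.image (cube ∘ γ)).card) θ β') :
    |-Real.log (zG blk Δ ℱ (fD (uD χ p ek B Φ c Ys V 1) cube γ₀ ∅) W W) -
        pertP (fun t => Real.log (zG blk Δ ℱ (fD (uD χ p ek B Φ c Ys V t) cube γ₀ ∅) W W)) nbar| ≤
      (nbar + 1 : ℝ) * ((Fintype.card (L → ↥B ⊕ ↥Ys) : ℝ) *
        ((θ ^ (1 - β')) ^ (nbar + 1) * (2 * (2 * Real.exp 2 * θ ^ β' * ((D : ℝ) + 1)) * W.card))) := by
  obtain ⟨hA, -⟩ := effectiveAction_fieldLaw_eq_pertP_add_remR_Tsum_of_ineq5144' blk Δ ℱ W adj χ cube hR hD hnbr hθ0 hθ1 hβ hsmall hχ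
    hp hΔ hPD hcube hΦloc hVloc hlin hc₀ hcb hV hK hek hek1 hL s₀ γ₀ h5144
  have hb := abs_remR_sum_Tsum_le_of_ineq5144 blk Δ ℱ W adj χ cube hR hD hnbr hθ0 hθ1 hβ hsmall hL h5144
  rw [hA, add_sub_cancel_left, abs_mul, abs_of_nonneg (by positivity : (0 : ℝ) ≤ nbar + 1)]
  exact mul_le_mul_of_nonneg_left hb (by positivity)

omit [Fintype L] [DecidableEq L] in
/-- **Print's `𝒫̃_{k+1}` IN THE MODEL = the cumulant sum of `−Ṽ` under the non-centred law**: `pertP (log z) n̄ = pertPart n̄ (cgf_{−Ṽ})` with `Ṽ = Σ_Y V_Y ∘ ext`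
under `fieldLaw blk Δ ℱ W` (hypotheses of `contDiffOn_uIcc_log_zG`). [cite: BalabanImbrieJaffe1988, (5.14.1) p.308] -/
theorem pertP_log_zG_eq_pertPart_cgf (hχ : ∀ x, 0 ≤ χ.χ₁ x) (hp : 1 / 2 < p) (hPD : (prec blk Δ W (corner ℝ W)).PosDef)
    (hcube : ∀ τ, cube τ ∈ W) (hlin : ∀ b ∈ B, IsLinearMap ℝ (Φ b)) {c₀ : ℝ} (hc₀ : 0 < c₀) (hcb : ∀ b ∈ B, c₀ ≤ c b)
    (hV : ∀ Y ∈ Ys, Measurable (V Y)) {KY : υ → ℝ} (hK : ∀ Y ∈ Ys, ∀ φ, |V Y φ| ≤ KY Y) (hek : 0 < ek) (hek1 : ek < Real.exp (-1))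
    (γ₀ : L → ↥B ⊕ ↥Ys) (nbar : ℕ) :
    pertP (fun t => Real.log (zG blk Δ ℱ (fD (uD χ p ek B Φ c Ys V t) cube γ₀ ∅) W W)) nbar =
      pertPart nbar (cgf (fun ω => -∑ Y ∈ Ys, V Y (ext blk W ω)) (fieldLaw blk Δ ℱ W)) := by
  haveI := isProbabilityMeasure_fieldLaw blk Δ ℱ W hPD
  have hz : ∀ t, zt χ p ek B (fun b ω => Φ b (ext blk W ω)) c Ys (fun Y ω => V Y (ext blk W ω)) (fieldLaw blk Δ ℱ W) t =
      zG blk Δ ℱ (fD (uD χ p ek B Φ c Ys V t) cube γ₀ ∅) W W := fun t =>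
    zt_fieldLaw_eq_zG blk Δ ℱ W χ p ek B Φ c Ys V cube hcube γ₀ t
  have h := pertP_log_zt_eq_pertPart_cgf_of_L1 χ (by linarith : 0 < p) (fieldLaw blk Δ ℱ W) (Φ := fun b ω => Φ b (ext blk W ω)) (c := c)
    (Ys := Ys) (V := fun Y ω => V Y (ext blk W ω)) (fun b hb => measurable_slotField blk W (hlin b hb)) hc₀ hcb
    (fun Y hY => (hV Y hY).comp (measurable_ext blk W)) (KY := KY) (fun Y hY ω => hK Y hY _) hek hek1
    (fun t ht => by
      rw [hz]
      exact (zG_fD_empty_pos blk Δ ℱ W χ cube hχ (by linarith) hPD hcube (fun b hb => (continuous_and_zero_of_isLinearMap (hlin b hb)).1)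
        (fun b hb => (continuous_and_zero_of_isLinearMap (hlin b hb)).2) hc₀ hcb hV hK hek γ₀ ht.1
        (BIJ88ZtPositivity308.mul_le_exp_neg_one_of_Ioc hek hek1.le ht)).ne')
    (slotFields_L1 blk Δ ℱ W χ hp hPD hlin hc₀ hcb hek) nbar
  simpa only [hz] using h

end Model

end Literature.MathematicalPhysics.QuantumFieldTheory.BalabanImbrieJaffe1984to88.BIJ88EffectiveActionNoncentred308

end
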